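import Mathlib
import HarnessLib
import HarnessLib.Audit
import Summits.Langlands.Statement
import HarnessLib.Audit.Check
import Literature.NumberTheory.GaloisRepresentations.LabelledHodgeTateWeights
import Literature.NumberTheory.GaloisRepresentations.CrystallineDeformationRing
import Literature.NumberTheory.GaloisRepresentations.ResidualGaloisRep
import HarnessLib.Audit.Status.Attr

/-!
Route: RamifiedCoefficientSeed

DORMANT since 2026-08-24T06:19:44Z (reconciler: no traction for 6.6 d (last activity item-evidence-added at 2026-08-17T15:55:15Z); parked, not closed — `ledger route dormant route-Langlands-RamifiedCoefficientSeed --off` to reactivate) — unstaffed, not closed; items shared with open routes are served there. `ledger route dormant <id> --off` reactivates.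

# Route RamifiedCoefficientSeed — conjugation-ramified coefficient primes make non-polarisable
rank-3 motives residually adjoint-odd, hence automorphic over Q

X (sector of direction (B), n = 3, F = ℚ, NON-polarisable): there is an infinite, pairwise
twist-inequivalent family of rank-3 p-adic
representations ρ of Γ_ℚ (intended: λ-adic realisations of explicit surfaces/motives with a
ℚ-rational action of a CM coefficient field E,
λ ∣ p ≥ 11 a prime of E FIXED by complex conjugation with trivial residual conjugation, i.e. λ⁺
ramified in E/E⁺) which are NOT essentially
self-dual, unramified a.e., crystalline with Hodge–Tate weights {0,1,2} at p, residually absolutely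
irreducible over ℚ(ζ_p), residually
essentially self-dual and with |tr ρ(c)| = 1 — and EVERY member is cuspidal automorphic on GL₃(𝔸_ℚ)
(Satake matching a.e.). X = NonPolarisableFamilyAutomorphic (the target item);
the three cruxes are: the explicit family exists (ExplicitRamifiedFamily, the computational/explicit
witness), residual duality + parity
forces an adjoint-ODD two-dimensional seed (AdjointSeedFromDuality, the new lever), and ACC+ lifting
from such a seed (AdjointLiftingGL3).
NonPolarisableFamilyAutomorphic → Langlands is the honestly-labelled SectorComplement. No card is
realised (none exists for this sector over ℚ).
Lean: `∃ (p : ℕ) (_ : Fact p.Prime), 11 ≤ p ∧ ∃ f : ℕ →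
Literature.NumberTheory.GaloisRepresentations.FramedGaloisRep ℚ (PadicAlgCl p) 3, (∀ m n, m ≠ n → ¬
∃ χ : Literature.NumberTheory.GaloisRepresentations.FramedGaloisRep ℚ (PadicAlgCl p) 1, ∀ σ, (f m
σ).val.trace = (χ σ).val 0 0 * (f n σ).val.trace) ∧ (∀ n, ¬ ∃ χ :
Literature.NumberTheory.GaloisRepresentations.FramedGaloisRep ℚ (PadicAlgCl p) 1, ∀ σ, (f n
σ⁻¹).val.trace = (χ σ).val 0 0 * (f n σ).val.trace) ∧ ∀ (n : ℕ) (ι : PadicAlgCl p ≃+* ℂ) (hcpt :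
Literature.NumberTheory.Automorphic.isCompact_glFiniteIntegralLevel 3 ℚ), ∃ π :
Literature.NumberTheory.Automorphic.CuspidalAutomorphicRepData 3 ℚ hcpt, π.1.IsLAlgebraic ∧ ∀ᶠ v :
IsDedekindDomain.HeightOneSpectrum (NumberField.RingOfIntegers ℚ) in Filter.cofinite,
Summit.Langlands.SatakeFrobCompatibleAt ι π.1 (f n) v`

## Assembly
Pure logic (sorry-free in Sketch.lean, `closes`/`target_of`): ExplicitRamifiedFamily gives p ≥ 11
and the family f; for each n the member f n
satisfies the hypotheses of AdjointSeedFromDuality (residual duality, residual absolute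
irreducibility over ℚ(ζ_p), trace-±1 conjugation;
5 ≤ 11 ≤ p), which outputs the odd adjoint seed (ρ₀, η); AdjointLiftingGL3 consumes a.e.-unramified
+ crystalline-{0,1,2} + irreducibility +
the seed and returns the cuspidal π with Satake matching a.e.; this is
NonPolarisableFamilyAutomorphic, and SectorComplement maps it to Langlands.

Rationale: WHY THIS LINE. LEVER (new on this summit): for an E-rational compatible system with the
unitary/Poincaré duality ρ^c ≅ ρ^∨ ⊗ μ (E a CM field), a prime λ of E
with c(λ) = λ and c ≡ id on O_E/λ — exactly a prime of E⁺ RAMIFIED in E/E⁺ — gives c(P_v) ≡ P_v,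
hence ρ̄_λ^ss ≅ (ρ̄_λ^ss)^∨ ⊗ μ̄ (Brauer–Nesbitt):
a NON-polarisable system is RESIDUALLY polarised at λ. In rank 3 over ℚ, Schur + odd rank make the
form symmetric, GO₃ = 𝔾_m·SO₃ ≅ 𝔾_m·PGL₂ and
Tate's lifting give ρ̄ ≅ ad⁰(τ̄) ⊗ ψ, and Hodge symmetry (tr ρ(c) = ±1 for Hodge numbers (1,1,1);
Caraiani–Le Hung arXiv:1409.2158 for r_ι(π))
forces τ̄ ODD since 3ψ(c) ≢ ±1 for p ≥ 5: Serre's conjecture (KhareWintenberger2009) then makes ρ̄ ≅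
Sym²-residually automorphic FOR FREE,
and ACCGHLNSTT2023 Thm 6.1.1 (FL, p > 9, F = ℚ allowed) / Thm 6.1.2 (ordinary, p > 3) +
Gelbart–Jacquet + the same-weight bookkeeping give
automorphy OVER ℚ — no Moret-Bailly, no potentiality (contrast Qian2022: Sym^(n-1) r_E seeds reached
over an uncontrolled extension). The
phenomenon accounts (in the generic residual-eigenvalue configuration at the level prime) for
Ash–Grayson–Green's forty-year-old unexplained remark (3) (AshGraysonGreen1984 p. 434: "the level p
is always a square in ℤ_l
for any l ramified in k") and was seen for one class by AshPinchTaylor1991 (Â₄ extension at the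
ramified prime 3 of ℚ(√-3)); it has never
been used as a residual-automorphy SEED. Imported: finite-group/Galois-cohomological image
conditions (ACC+ "enormous", a GAP certificate at small
p), explicit algebraic geometry (surfaces with rational ℤ/p^k symmetry, eigenspace Hodge
numerology), Fontaine–Laffaille weight bookkeeping. Versus
the 43 open routes: none addresses direction (B) for non-polarisable motives over ℚ
(IrreducibilityBySelfDuality uses self-dual GL₃ = Ad(GL₂) in
the (A)/irreducibility direction; KleinTorsionDoor/PicardMuOrdinary/OccultE6Transport get free
residual automorphy from exceptional isomorphisms,
not from coefficient ramification); the negatives index (one prime-free-set typing kill) is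
untouched.

RANKED CRUXES. #0 NonPolarisableFamilyAutomorphic (target) — an infinite pairwise twist-inequivalent
family of non-essentially-self-dual rank-3 p-adic representations of Γ_ℚ (p ≥ 11), every member
cuspidal automorphic on GL₃(𝔸_ℚ) with Satake–Frobenius matching at almost all places. (why it might
fail: the only explicit non-self-dual rank-3 motives in print (van Geemen–Top families) have E =
ℚ(i), ℚ(√-3), whose conjugation-ramified primes lie over 2, 3 — below every lifting theorem;
families with p ≥ 11 must be constructed.) [VangeemenTop1994, ItoKoshikawaMieda2018,
AshGraysonGreen1984, Porat2024, ACCGHLNSTT2023]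
#2 ExplicitRamifiedFamily (crux) — [explicit witness, compute/AG seat] exhibit an infinite, pairwise
twist-inequivalent family f : ℕ → (Γ_ℚ → GL₃(ℚ̄_p)), p ≥ 11, of NON-essentially-self-dual
representations, each unramified a.e., crystalline with labelled HT weights {0,1,2} at p (pinned
Fontaine datum), residually absolutely irreducible over ℚ(ζ_p), residually essentially self-dual
(trace form) and with a complex conjugation of trace ±1. Intended source: λ-adic pieces of H² of
surfaces over ℚ carrying a ℚ-rational automorphism of prime-power order p^k (E = ℚ(ζ_(p^k)), λ =
(1−ζ) the unique conjugation-ramified prime) with good reduction at p and one E-eigenspace of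
transcendental rank 3 with Hodge numbers (1,1,1); the search is finite character theory (holomorphic
Lefschetz / Chevalley–Weil for product-quotient and Z/p^k-invariant complete-intersection families)
+ point counts (big mod-λ monodromy, ordinarity). [difficulty: L] (why it might fail: numerology: a
free ℤ/m-quotient Y with χ(O_Y)=1 gives eigenspace rank 12−K_Y² (rank 3 ⇔ fake planes, rigid);
E-rank-3 (1,1,1) pieces need p_g ≥ φ(p^k) ≥ 10 and Picard number h^(1,1) − φ(p^k); product-quotients
and H³ of threefolds are excluded by parity/Hodge arguments.) [VangeemenTop1994,
ItoKoshikawaMieda2018, AshGraysonGreen1984, Porat2024]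
#3 AdjointLiftingGL3 (crux) — [engine] p ≥ 11; ρ : Γ_ℚ → GL₃(ℚ̄_p) unramified a.e., crystalline at p
with labelled HT weights {0,1,2}, ρ̄|ℚ(ζ_p) absolutely irreducible, and ρ̄ ≡ η ⊗ ad⁰(ρ₀) (mod 𝔪) for
some ODD ρ₀ : Γ_ℚ → GL₂(ℚ̄_p) and character η ⇒ for every ι and hcpt there is a cuspidal L-algebraic
π on GL₃(𝔸_ℚ) with Satake–Frobenius matching a.e. Proof plan: ρ̄₀ odd irreducible non-dihedral ⇒
modular (Khare–Wintenberger + Kisin); FL structure of ρ pins ρ̄₀ ⊗ ω^b to Serre weight 2 (finite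
flat or ω₂-supersingular), so a weight-2 level-prime-to-p newform g and π₀ := Sym² g ⊗ χ
(Gelbart–Jacquet, cuspidal as ad⁰ρ̄₀ is irreducible) give ρ̄ ≅ ρ̄_(π₀,ι) in the SAME weight; ACC+
Thm 6.1.1 over F = ℚ (p > n² = 9; enormous image of the ad⁰-type subgroup; decomposed-generic and
scalar-element conditions from Dickson + Chebotarev) ⇒ ρ ≅ r_ι(Π). [difficulty: L] (why it might
fail: ACC+ Def 6.2.28(3) ("enormous") may fail for ad⁰-images of A₄/S₄/A₅/PGL₂(p^r) type at
particular p (finite check), and the same-weight step needs "FL reduction of ad⁰(τ̄)⊗ψ ⇒ τ̄⊗ω^b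
finite flat" — unproved bookkeeping; else an extra hypothesis is needed.) [ACCGHLNSTT2023,
MiagkovThorne2022, KhareWintenberger2009, GelbartJacquet1978, Edixhoven1992,
HarrisLanTaylorThorneRMS2016]
#4 AdjointSeedFromDuality (crux) — [the lever, typed residually] p ≥ 5; ρ : Γ_ℚ → GL₃(ℚ̄_p) with
ρ̄ˢˢ ≅ (ρ̄ˢˢ)^∨ ⊗ ν̄ (trace form: tr ρ(σ) ≡ ν(σ) tr ρ(σ⁻¹) mod 𝔪), ρ̄|ℚ(ζ_p) absolutely irreducible,
and some complex conjugation of trace ±1 ⇒ ∃ ODD ρ₀ : Γ_ℚ → GL₂(ℚ̄_p) and a character η with tr ρ ≡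
η·(tr(ρ₀)²/det ρ₀ − 1) mod 𝔪. (Schur ⇒ symmetric form; GO₃ = 𝔾_m·SO₃ ≅ 𝔾_m·PGL₂(𝔽̄_p); Tate lifting
of the projective representation; 3η(c) ≢ ±1 mod p forces τ̄ odd; an odd p-adic lift ρ₀ of τ̄ exists
by Serre's conjecture (ρ_g) or Ramakrishna.) The hypothesis is what a conjugation-ramified prime of
a CM coefficient field delivers (unitarity for r_ι(π); Poincaré duality with Rosati = conjugation
for motives), and |tr ρ(c)| = 1 is Hodge symmetry for Hodge numbers (1,1,1) (Caraiani–Le Hung for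
r_ι(π)). [difficulty: M] (why it might fail: as typed the odd lift ρ₀ must exist in characteristic 0
with the exact congruence for ALL σ: needs Serre's conjecture (or Ramakrishna) for τ̄ and η =
Teichmüller(ψ); a subtle failure mode is τ̄ odd but EVERY lift obstructed at p = 5, 7 with tiny
image.) [AshPinchTaylor1991, AshGraysonGreen1984, CaraianiHung2014, KhareWintenberger2009,
DarmonDiamondTaylor1995]
#5 SectorComplement (crux) — OUT-OF-SCOPE REMAINDER = the rest of the summit:
NonPolarisableFamilyAutomorphic → Langlands (direction (A), every other (n, F), local–global
compatibility at all places, the data 𝓡, and all rank-3 motives outside the explicit family).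
Trivially implied by Langlands; filed only so that `closes` honestly concludes the summit constant
(same convention as PicardMuOrdinary.SectorComplement, E8QuinticResidue.SectorComplement). Graders:
judge the route on cruxes 2–4. [deps: ExplicitRamifiedFamily, AdjointSeedFromDuality,
AdjointLiftingGL3] [difficulty: open-problem] (why it might fail: it is summit-hard by construction
(contains direction (A), all n ≠ 3 and all F ≠ ℚ); never staffed from this route.)
[BuzzardGeeLMS2014, Calegari2023]

TWO-LAYER PLAN. AdjointLiftingGL3 ⇐ SameWeightSeed (FL reduction of ad⁰(τ̄)⊗ψ with weights {0,1,2} ⇒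
k(τ̄⊗ω^b) = 2, so ρ̄ ≅ ρ̄_(Sym² g ⊗ χ) with g of weight 2
and level prime to p) → EnormousAdjointImages (every ad⁰-type absolutely irreducible H ≤ GL₃(𝔽̄_p),
p ≥ 11, restricted to ℚ(ζ_p), is
enormous, decomposed generic, with a scalar element off G_ℚ(ζ_p)) → AdjointLiftingGL3 (ACC+ 6.1.1
applied). ExplicitRamifiedFamily ⇐
HodgeEigenspaceWitness (one explicit family with the (1,1,1) E-eigenspace, by character theory) →
ArithmeticAdmissibility (ℚ-rational action,
good reduction and big mod-λ monodromy at p, ordinarity when the Thm 6.1.2 branch is used) →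
ExplicitRamifiedFamily. Depth 1, k ≤ 3 each.

KILL CRITERIA. A refutation of AdjointSeedFromDuality (a ρ meeting the
residual-duality/irreducibility/trace hypotheses with no odd adjoint seed) kills the
lever: close refuted:AdjointSeedFromDuality. A refutation of AdjointLiftingGL3 AS TYPED would
exhibit a geometric ρ contradicting Fontaine–Mazur
— report needs-human rather than pivot. If a theorem shows the Hodge numerology forbids rank-3
(1,1,1) eigenpieces for every prime power
p^k ≥ 11 (ExplicitRamifiedFamily refuted), pivot ONCE to the ordinary branch at p ∈ {5,7} (E =
ℚ(ζ₅), ℚ(ζ₇)/ℚ(√-7); ACC+ Thm 6.1.2, p > 3)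
with the image table deciding admissible residual images; if that is empty too, retire. Mooted if
BLGGT-strength (potential ⇒ actual)
automorphy for all regular rank-3 motives over ℚ is proved elsewhere (Calegari2023 §11.1 "within
reach").

NOT DECOMPOSED YET. The enormous-image table at p ∈ {11,13} and the A₄/S₄/A₅ ad⁰-types (finite GAP
computation; kit job j019854 queued), the same-weight lemma,
decomposed-genericity for ad⁰-images (Chebotarev inside ℚ(ad⁰τ̄, ζ_p)), and the explicit surface
search are layer-2 children; the (A)-side
consistency check on Ash–Grayson–Green's level-53 class (kit job j019849) is evidence, not an item.
No constants are tuned: p ≥ 11 is ACC+'s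
p > n², p ≥ 5 is Brauer–Nesbitt-by-traces (p > rank) and 3 ≢ ±1.

CHEAPEST FALSIFIER. (a) LOOKUP, run 2026-08-16: is "automorphy over ℚ of non-self-dual rank-3
motives via residual Sym²/ad⁰ at a ramified coefficient prime" in
print? zbMATH ("non-selfdual Galois representation GL(3)", "selfdual and non-selfdual
3-dimensional", "automorphy lifting non-polarizable rank 3
motive"), arXiv, Calegari's survey arXiv:2109.14145 §10–11 (read), Qian arXiv:2104.09761 (read:
potential only, Dwork + Sym^(n-1) seed),
ItoKoshikawaMieda2018 (read: one instance by Faltings–Serre–Grenié): not found. (b) COMPUTE,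
running: the (A)-side prediction on REAL DATA —
the Ash–Grayson–Green level-53 non-selfdual class (Hecke field ℚ(√-11)) reduced mod (√-11) must
satisfy e_l ≡ l·(t_l²/d_l − 1) for a mod-11
eigenform of level 53 or 1, weight ≤ 12 (u_l = e_l/l + 1 = (0,8,10,10,8,1,1,1,8) at l =
2,3,5,7,13,17,19,23,29 from AGG Table I): PARI job
j019849 (queued at filing; a clean miss would falsify the lever's normalisation and must be
explained before staffing). The lemma already
predicts AGG's printed unexplained observation (3) whenever the level prime's residual eigenvalue of
the unramified character is isolated (then p·1 = γ² for the Steinberg eigenvalue γ ∈ 𝔽_l).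

NUMBERS. ACC+ Thm 6.1.1: p > n² = 9, weight inequality 0 < p − 2n; Thm 6.1.2: p > n = 3
(ACCGHLNSTT2023 §6.1, read verbatim). H¹(SL₂(𝔽_p), Sym^(p−3)) ≠ 0,
so the ad⁰-image PSL₂(𝔽₅) (sl₃ ⊃ V₂) and PSL₂(𝔽₇) (sl₃ ⊃ V₄) are NOT enormous; p ≥ 11 is clean for
PSL₂(𝔽_p) (table: kit j019854).
Non-selfdual cuspidal GL₃/ℚ classes of prime level: 53 (ℚ(√-11)), 61 (ℚ(√-3)), 79 (ℚ(√-15)), 89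
(AshGraysonGreen1984 Table I); ≤ 337
(vGvdKTV 1997); 521, 953, 1289, 1433 (Porat2024). van Geemen–Top: level 128, E = ℚ(i), proved
automorphic with LGC at 2 (ItoKoshikawaMieda2018).
Eigenspace numerology: free ℤ/m-quotient Y of a p_g = m−1 surface, χ(O_Y) = 1 ⇒ each non-trivial
eigenspace has rank 12 − K_Y².

DEFINITION REQUESTS. None: every item is typed over the Statement's cone plus
LabelledHodgeTateWeights / CrystallineDeformationRing / ResidualGaloisRep
(IsCrystallineFramed at Fontaine's pinned datum, labelledHodgeTateWeightsAt,
IsResiduallyAbsIrreducible, IsOdd, IsComplexConjugation).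
Compute-infra (to be filed after open, not Lean): eigenspace-Hodge-number calculator for group
actions on product-quotient / complete-intersection
surfaces (Chevalley–Weil), and the GAP enormous-image checker (job j019854's script
jobs/adj_image_h1.g).

Novelty: Searches (2026-08-16): zbMATH "Booker poles of Artin L-functions strong Artin" (1, read), "Gunnells
Yasaki cubic field discriminant -23" (2, §7 read),
"non-selfdual automorphic representation GL(3) Galois representation van Geemen Top" (2),
"non-selfdual Galois representation GL(3)" (3),
"selfdual and non-selfdual 3-dimensional Galois representations" (1), "van Geemen Top
three-dimensional Galois representations surfaces" (0),
"automorphy lifting non-polarizable rank 3 motive" (0), "Ash Pinch Taylor extension attached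
non-selfdual automorphic form GL(3)" (1; paywalled,
acq-06326), "Ash Grayson Green computations cuspidal cohomology SL(3,Z)" (2: AGG 1984 read Table I +
remarks; Porat 2024 read), "Qian potential
automorphy GL(n)" (read), "Miagkov Thorne automorphy lifting adequate image" (1), arXiv "automorphy
non-self-dual three-dimensional Galois
representations surfaces compatible system GL(3)" (0); lit read arXiv:1811.11544 pp.1–4,
arXiv:2109.14145 §10–11, arXiv:1812.09999 §6.1,
arXiv:2104.09761 (grep); galaxy --star all "even icosahedral" (noise); all 43 open route headers +
the Ideas pool (open and _closed) grepped for
van Geemen / non-selfdual / non-polarisable / ramified coefficient (hits: purity-from-empty-weights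
mentions "e.g. ρ̄ ≡ Sym² ρ̄_f ⊗ χ̄; apparently
unharvested" as an aside; conjugate-asymmetric-motives-cm is the CM-base-field irregular twin; no
route).
Nearest prior art found: AshPinchTaylor1991 (doi:10.1007/bf01445238: the residual Â₄ structure of
one non-  [refs: 10.1007/bf01445238:, 1811.11544, 2109.14145, 1812.09999, 2104.09761, doi:10.1007/bf01445238, AshPinchTaylor1991, ItoKoshikawaMieda2018, Qian2022, ACCGHLNSTT2023]

Barriers (technique_class: automorphy-lifting, residual-duality, explicit-motives): - technique_class: automorphy-lifting, residual-duality, explicit-motives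
- Literature.Barriers.Langlands.TaylorWilesNumericalCoincidence: met and evaded as the barrier's own
recorded evasion — GL₃/ℚ non-polarisable has defect l₀ = 1, so the engine is ACC+'s positive-defect
patching of complexes (Thm 6.1.1/6.1.2), never single-degree Taylor–Wiles; the residual input is
exactly what ACC+ asks for.
- Literature.Barriers.Langlands.TaylorWilesNumericalCoincidenceNarrow: this is precisely clause (β)
with F = ℚ totally real, n = 3, r NOT essentially self-dual — the narrow barrier blocks defect-ZERO
patching for such r; evaded by using ACCGHLNSTT2023 §6 (Calegari–Geraghty patching in positive
defect with torsion local–global compatibility), which is the narrow entry's named exit; no definite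
unitary group or defect-zero R = T is invoked for ρ itself (only for the residual seed Sym² g, which
is polarised and where nothing is patched).
- Literature.Barriers.Langlands.ResiduallyReducibleBarrier: respected, not evaded — every crux
carries residual absolute irreducibility over ℚ(ζ_p); the lever's point is that coefficient
ramification yields BIG (ad⁰ of PSL₂-type) residual images, not Eisenstein ones; reducible
reductions are outside the sector.
- Literature.Barriers.Langlands.ResiduallyReducibleBarrierNarrow: same — the Taylor–Wiles image
hypotheses (absolute irreducibility over F(ζ_p), enormous image) are HYPOTHESES of
AdjointLiftingGL3, verified for ad⁰-type images by a finite-group c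

History (route lifecycle, newest last):
- 2026-08-17T08:37:48Z · rev 3: dropped stmt-Langlands-19093, stmt-Langlands-13622 — route-repair (rrepair e75b8072, unused-crux) step 1/2: DROP the two promoted Jacquet–Shalika literature inputs PairLPoleJS (stmt-19093, AC (2.3)) and PairLBound (planner-rrepair-Langlands-RamifiedCoefficientS-e75b8072-0)
- 2026-08-24T06:19:44Z · DORMANT — reconciler: no traction for 6.6 d (last activity item-evidence-added at 2026-08-17T15:55:15Z); parked, not closed — `ledger route dormant route-Langlands-Ramifi (operator:999:3653075)

sub-problem: Langlands · status: dormant · opened planner-plan-novel-Langlands-Langlands-e266a39d-d-v2-g8-0 2026-08-16T20:49:08Z · rev 3 · ledger route-Langlands-RamifiedCoefficientSeed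
GENERATED by the gate from the ledger (D-0016/17). Provers cite these decls: `theorem foo : Summit.Langlands.Langlands.Theses.RamifiedCoefficientSeed.<Decl> := …` in Summits/Langlands/Langlands/Theorems/<Name>.lean.
-/

namespace Summit.Langlands.Langlands.Theses.RamifiedCoefficientSeed

open scoped BigOperators Topology Manifold Classical MeasureTheory ProbabilityTheory Matrix InnerProductSpace ComplexConjugate ContinuousMap
open Filter Set Function TopologicalSpace MeasureTheory

attribute [summit_statement] _root_.Langlands

/-- item stmt-Langlands-16777 · target · rank 0 · open · by planner
why it might fail: the only explicit non-self-dual rank-3 motives in print (van Geemen–Top families) have E = ℚ(i), ℚ(√-3), whose conjugation-ramified primes lie over 2, 3 — below every lifting theorem; families with p ≥ 11 must be constructed.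
sources: VangeemenTop1994, ItoKoshikawaMieda2018, AshGraysonGreen1984, Porat2024, ACCGHLNSTT2023
[target] an infinite pairwise twist-inequivalent family of non-essentially-self-dual rank-3 p-adic
representations of Γ_ℚ (p ≥ 11), every member cuspidal automorphic on GL₃(𝔸_ℚ) with Satake–Frobenius
matching at almost all places. -/
@[route_item "route-Langlands-RamifiedCoefficientSeed"]
def NonPolarisableFamilyAutomorphic : Prop :=
  ∃ (p : ℕ) (_ : Fact p.Prime), 11 ≤ p ∧ ∃ f : ℕ → Literature.NumberTheory.GaloisRepresentations.FramedGaloisRep ℚ (PadicAlgCl p) 3, (∀ m n, m ≠ n → ¬ ∃ χ : Literature.NumberTheory.GaloisRepresentations.FramedGaloisRep ℚ (PadicAlgCl p) 1, ∀ σ, (f m σ).val.trace = (χ σ).val 0 0 * (f n σ).val.trace) ∧ (∀ n, ¬ ∃ χ : Literature.NumberTheory.GaloisRepresentations.FramedGaloisRep ℚ (PadicAlgCl p) 1, ∀ σ, (f n σ⁻¹).val.trace = (χ σ).val 0 0 * (f n σ).val.trace) ∧ ∀ (n : ℕ) (ι : PadicAlgCl p ≃+* ℂ) (hcpt : Literature.NumberTheory.Automorphic.isCompact_glFiniteIntegralLevel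 3 ℚ), ∃ π : Literature.NumberTheory.Automorphic.CuspidalAutomorphicRepData 3 ℚ hcpt, π.1.IsLAlgebraic ∧ ∀ᶠ v : IsDedekindDomain.HeightOneSpectrum (NumberField.RingOfIntegers ℚ) in Filter.cofinite, Summit.Langlands.SatakeFrobCompatibleAt ι π.1 (f n) v

/-- item stmt-Langlands-16778 · crux · rank 2 · open · by planner
why it might fail: numerology: a free ℤ/m-quotient Y with χ(O_Y)=1 gives eigenspace rank 12−K_Y² (rank 3 ⇔ fake planes, rigid); E-rank-3 (1,1,1) pieces need p_g ≥ φ(p^k) ≥ 10 and Picard number h^(1,1) − φ(p^k); product-quotients and H³ of threefolds are excluded by parity/Hodge arguments.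
sources: VangeemenTop1994, ItoKoshikawaMieda2018, AshGraysonGreen1984, Porat2024
[crux] [explicit witness, compute/AG seat] exhibit an infinite, pairwise twist-inequivalent family f
: ℕ → (Γ_ℚ → GL₃(ℚ̄_p)), p ≥ 11, of NON-essentially-self-dual representations, each unramified a.e.,
crystalline with labelled HT weights {0,1,2} at p (pinned Fontaine datum), residually absolutely
irreducible over ℚ(ζ_p), residually essentially self-dual (trace form) and with a complex
conjugation of trace ±1. Intended source: λ-adic pieces of H² of surfaces over ℚ carrying a
ℚ-rational automorphism of prime-power order p^k (E = ℚ(ζ_(p^k)), λ = (1−ζ) the unique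
conjugation-ramified prime) with good reduction at p and one E-eigenspace of transcendental rank 3
with Hodge numbers (1,1,1); the search is finite character theory (holomorphic Lefschetz /
Chevalley–Weil for product-quotient and Z/p^k-invariant complete-intersection families) + point
counts (big mod-λ monodromy, ordinarity). [difficulty: L] -/
@[route_item "route-Langlands-RamifiedCoefficientSeed", crux]
def ExplicitRamifiedFamily : Prop :=
  ∃ (p : ℕ) (_ : Fact p.Prime), 11 ≤ p ∧ ∃ f : ℕ → Literature.NumberTheory.GaloisRepresentations.FramedGaloisRep ℚ (PadicAlgCl p) 3, (∀ m n, m ≠ n → ¬ ∃ χ : Literature.NumberTheory.GaloisRepresentations.FramedGaloisRep ℚ (PadicAlgCl p) 1, ∀ σ, (f m σ).val.trace = (χ σ).val 0 0 * (f n σ).val.trace) ∧ ∀ n, (¬ ∃ χ : Literature.NumberTheory.GaloisRepresentations.FramedGaloisRep ℚ (PadicAlgCl p) 1, ∀ σ, (f n σ⁻¹).val.trace = (χ σ).val 0 0 * (f n σ).val.trace) ∧ (∀ᶠ v : IsDedekindDomain.HeightOneSpectrum (NumberField.RingOfIntegers ℚ) in Filter.cofinite, (f n).IsUnramifiedAt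 v) ∧ (∀ (v : IsDedekindDomain.HeightOneSpectrum (NumberField.RingOfIntegers ℚ)) (hv : ((p : ℕ) : NumberField.RingOfIntegers ℚ) ∈ v.asIdeal), let D := Literature.NumberTheory.PAdicHodge.fontainePstAdicCompletion v p hv; D.IsCrystallineFramed ((f n).toLocal v) ∧ (letI := D.algebra; ∀ τ : v.adicCompletion ℚ →ₐ[ℚ_[p]] PadicAlgCl p, (f n).labelledHodgeTateWeightsAt v D.algebra D.𝔅 τ.toRingHom = {0, 1, 2})) ∧ (∃ ν : Literature.NumberTheory.GaloisRepresentations.FramedGaloisRep ℚ (PadicAlgCl p) 1, ∀ σ, ‖(f n σ).val.trace - (ν σ).val 0 0 * (f n σ⁻¹).val.trace‖ < 1) ∧ ((f n).restrictField (CyclotomicField p ℚ)).IsResiduallyAbsIrreducible ∧ (∃ (φ : ℚ →+* ℝ) (c : Field.absoluteGaloisGroup ℚ), Literature.NumberTheory.GaloisRepresentations.IsComplexConjugation φ c ∧ (((f n) c).val.trace = 1 ∨ ((f n) c).val.trace = -1))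

/-- item stmt-Langlands-16779 · crux · rank 3 · open · by planner
why it might fail: ACC+ Def 6.2.28(3) ("enormous") may fail for ad⁰-images of A₄/S₄/A₅/PGL₂(p^r) type at particular p (finite check), and the same-weight step needs "FL reduction of ad⁰(τ̄)⊗ψ ⇒ τ̄⊗ω^b finite flat" — unproved bookkeeping; else an extra hypothesis is needed.
sources: ACCGHLNSTT2023, MiagkovThorne2022, KhareWintenberger2009, GelbartJacquet1978, Edixhoven1992, HarrisLanTaylorThorneRMS2016
[crux] [engine] p ≥ 11; ρ : Γ_ℚ → GL₃(ℚ̄_p) unramified a.e., crystalline at p with labelled HT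
weights {0,1,2}, ρ̄|ℚ(ζ_p) absolutely irreducible, and ρ̄ ≡ η ⊗ ad⁰(ρ₀) (mod 𝔪) for some ODD ρ₀ :
Γ_ℚ → GL₂(ℚ̄_p) and character η ⇒ for every ι and hcpt there is a cuspidal L-algebraic π on GL₃(𝔸_ℚ)
with Satake–Frobenius matching a.e. Proof plan: ρ̄₀ odd irreducible non-dihedral ⇒ modular
(Khare–Wintenberger + Kisin); FL structure of ρ pins ρ̄₀ ⊗ ω^b to Serre weight 2 (finite flat or
ω₂-supersingular), so a weight-2 level-prime-to-p newform g and π₀ := Sym² g ⊗ χ (Gelbart–Jacquet,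
cuspidal as ad⁰ρ̄₀ is irreducible) give ρ̄ ≅ ρ̄_(π₀,ι) in the SAME weight; ACC+ Thm 6.1.1 over F = ℚ
(p > n² = 9; enormous image of the ad⁰-type subgroup; decomposed-generic and scalar-element
conditions from Dickson + Chebotarev) ⇒ ρ ≅ r_ι(Π). [difficulty: L] -/
@[route_item "route-Langlands-RamifiedCoefficientSeed", crux]
def AdjointLiftingGL3 : Prop :=
  ∀ (p : ℕ) [Fact p.Prime], 11 ≤ p → ∀ ρ : Literature.NumberTheory.GaloisRepresentations.FramedGaloisRep ℚ (PadicAlgCl p) 3, (∀ᶠ v : IsDedekindDomain.HeightOneSpectrum (NumberField.RingOfIntegers ℚ) in Filter.cofinite, ρ.IsUnramifiedAt v) → (∀ (v : IsDedekindDomain.HeightOneSpectrum (NumberField.RingOfIntegers ℚ)) (hv : ((p : ℕ) : NumberField.RingOfIntegers ℚ) ∈ v.asIdeal), let D := Literature.NumberTheory.PAdicHodge.fontainePstAdicCompletion v p hv; D.IsCrystallineFramed (ρ.toLocal v) ∧ (letI := D.algebra; ∀ τ : v.adicCompletion ℚ →ₐ[ℚ_[p]] PadicAlgCl p, ρ.labelledHodgeTateWeightsAt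 v D.algebra D.𝔅 τ.toRingHom = {0, 1, 2})) → (ρ.restrictField (CyclotomicField p ℚ)).IsResiduallyAbsIrreducible → (∃ (ρ₀ : Literature.NumberTheory.GaloisRepresentations.FramedGaloisRep ℚ (PadicAlgCl p) 2) (η : Literature.NumberTheory.GaloisRepresentations.FramedGaloisRep ℚ (PadicAlgCl p) 1), ρ₀.IsOdd ∧ ∀ σ, ‖(ρ σ).val.trace - (η σ).val 0 0 * ((ρ₀ σ).val.trace ^ 2 * ((ρ₀ σ).val.det)⁻¹ - 1)‖ < 1) → ∀ (ι : PadicAlgCl p ≃+* ℂ) (hcpt : Literature.NumberTheory.Automorphic.isCompact_glFiniteIntegralLevel 3 ℚ), ∃ π : Literature.NumberTheory.Automorphic.CuspidalAutomorphicRepData 3 ℚ hcpt, π.1.IsLAlgebraic ∧ ∀ᶠ v : IsDedekindDomain.HeightOneSpectrum (NumberField.RingOfIntegers ℚ) in Filter.cofinite, Summit.Langlands.SatakeFrobCompatibleAt ι π.1 ρ v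

/-- item stmt-Langlands-16780 · crux · rank 4 · open · by planner
why it might fail: as typed the odd lift ρ₀ must exist in characteristic 0 with the exact congruence for ALL σ: needs Serre's conjecture (or Ramakrishna) for τ̄ and η = Teichmüller(ψ); a subtle failure mode is τ̄ odd but EVERY lift obstructed at p = 5, 7 with tiny image.
sources: AshPinchTaylor1991, AshGraysonGreen1984, CaraianiHung2014, KhareWintenberger2009, DarmonDiamondTaylor1995
[crux] [the lever, typed residually] p ≥ 5; ρ : Γ_ℚ → GL₃(ℚ̄_p) with ρ̄ˢˢ ≅ (ρ̄ˢˢ)^∨ ⊗ ν̄ (trace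
form: tr ρ(σ) ≡ ν(σ) tr ρ(σ⁻¹) mod 𝔪), ρ̄|ℚ(ζ_p) absolutely irreducible, and some complex
conjugation of trace ±1 ⇒ ∃ ODD ρ₀ : Γ_ℚ → GL₂(ℚ̄_p) and a character η with tr ρ ≡ η·(tr(ρ₀)²/det ρ₀
− 1) mod 𝔪. (Schur ⇒ symmetric form; GO₃ = 𝔾_m·SO₃ ≅ 𝔾_m·PGL₂(𝔽̄_p); Tate lifting of the projective
representation; 3η(c) ≢ ±1 mod p forces τ̄ odd; an odd p-adic lift ρ₀ of τ̄ exists by Serre's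
conjecture (ρ_g) or Ramakrishna.) The hypothesis is what a conjugation-ramified prime of a CM
coefficient field delivers (unitarity for r_ι(π); Poincaré duality with Rosati = conjugation for
motives), and |tr ρ(c)| = 1 is Hodge symmetry for Hodge numbers (1,1,1) (Caraiani–Le Hung for
r_ι(π)). [difficulty: M] -/
@[route_item "route-Langlands-RamifiedCoefficientSeed", crux]
def AdjointSeedFromDuality : Prop :=
  ∀ (p : ℕ) [Fact p.Prime], 5 ≤ p → ∀ ρ : Literature.NumberTheory.GaloisRepresentations.FramedGaloisRep ℚ (PadicAlgCl p) 3, (∃ ν : Literature.NumberTheory.GaloisRepresentations.FramedGaloisRep ℚ (PadicAlgCl p) 1, ∀ σ, ‖(ρ σ).val.trace - (ν σ).val 0 0 * (ρ σ⁻¹).val.trace‖ < 1) → (ρ.restrictField (CyclotomicField p ℚ)).IsResiduallyAbsIrreducible → (∃ (φ : ℚ →+* ℝ) (c : Field.absoluteGaloisGroup ℚ), Literature.NumberTheory.GaloisRepresentations.IsComplexConjugation φ c ∧ ((ρ c).val.trace = 1 ∨ (ρ c).val.trace = -1)) → ∃ (ρ₀ : Literature.NumberTheory.GaloisRepresentations.FramedGaloisRep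 ℚ (PadicAlgCl p) 2) (η : Literature.NumberTheory.GaloisRepresentations.FramedGaloisRep ℚ (PadicAlgCl p) 1), ρ₀.IsOdd ∧ ∀ σ, ‖(ρ σ).val.trace - (η σ).val 0 0 * ((ρ₀ σ).val.trace ^ 2 * ((ρ₀ σ).val.det)⁻¹ - 1)‖ < 1

/-- item stmt-Langlands-16781 · crux · rank 5 · open · by planner
why it might fail: it is summit-hard by construction (contains direction (A), all n ≠ 3 and all F ≠ ℚ); never staffed from this route.
sources: BuzzardGeeLMS2014, Calegari2023
[crux] OUT-OF-SCOPE REMAINDER = the rest of the summit: NonPolarisableFamilyAutomorphic → Langlands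
(direction (A), every other (n, F), local–global compatibility at all places, the data 𝓡, and all
rank-3 motives outside the explicit family). Trivially implied by Langlands; filed only so that
`closes` honestly concludes the summit constant (same convention as
PicardMuOrdinary.SectorComplement, E8QuinticResidue.SectorComplement). Graders: judge the route on
cruxes 2–4. [deps: ExplicitRamifiedFamily, AdjointSeedFromDuality, AdjointLiftingGL3] [difficulty:
open-problem] -/
@[route_item "route-Langlands-RamifiedCoefficientSeed", crux]
def SectorComplement : Prop :=
  NonPolarisableFamilyAutomorphic → _root_.Langlands

-- item stmt-Langlands-16799 · support · rank 9 · open · by planner — informal only, no Lean statement yet: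
--   [support] (finite-group certificate, layer-2 child of AdjointLiftingGL3) For every prime p ≥ 11 and
--   every subgroup H ≤ GL₃(𝔽̄_p) of the form ψ·ad⁰(G̃) with G̃ ≤ GL₂(𝔽̄_p) absolutely irreducible and
--   non-dihedral (Dickson: projective image PSL₂(𝔽_q), PGL₂(𝔽_q), A₄, S₄, A₅), and every subgroup H′ ≤ H
--   of index ≤ 2 (restriction to ℚ(ζ_p)) acting absolutely irreducibly: H′ is enormous in the sense of
--   ACCGHLNSTT2023 Def 6.2.28 (tree: Subgroup.IsEnormous) — no p-power quotient, H⁰(H′, sl₃)=H¹(H′,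
--   sl₃)=0, regular-semisimple condition (3). Certificate: GAP (jobs/adj_image_h1.g, kit j019854) for q
--   ∈ {11,

-- item stmt-Langlands-16800 · support · rank 9 · open · by planner — informal only, no Lean statement yet:
--   [support] (layer-2 child of AdjointLiftingGL3; Fontaine–Laffaille bookkeeping) p ≥ 5; ρ : Γ_ℚ →
--   GL₃(ℚ̄_p) crystalline at p with HT weights {0,1,2} and ρ̄ ≅ ad⁰(τ̄) ⊗ ψ absolutely irreducible. Then
--   for some b, τ̄ ⊗ ω^{-b} restricted to I_p is either finite flat ordinary-type (sub ω, quotient 1,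
--   peu ramifié) or ω₂ ⊕ ω₂^p (supersingular), i.e. k(τ̄ ⊗ ω^{-b}) = 2 in Serre–Edixhoven normalisation;
--   hence (Khare–Wintenberger + Edixhoven/Ribet level–weight optimisation) there is a newform g of
--   weight 2 and level prime to p and a Dirichlet character χ unramified at p with ρ̄ ≅ ρ̄_{Sym² g ⊗ χ,
--   ι}, Sym²

-- item stmt-Langlands-16929 · support · rank 9 · open · by planner — informal only, no Lean statement yet:
--   [support] (sharpening of AdjointSeedFromDuality in the NATURAL normalisation; provable now on paper,
--   M-sized in Lean) Let p ≥ 5 and ρ : Γ_ℚ → GL₃(ℚ̄_p) with det ρ = ε⁻³ (up to a finite character of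
--   order prime to 3·2?) and residual duality ρ̄ˢˢ ≅ ρ̄ˢˢ∨ ⊗ ω̄⁻² (what ρ^c ≅ ρ^∨ ⊗ ε⁻² gives at a
--   conjugation-ramified coefficient prime: Poincaré duality on H², unitarity for r_ι(π)). If ρ̄ is
--   absolutely irreducible then ρ̄ ≅ ad⁰(τ̄) ⊗ ω⁻¹ EXACTLY (ψ³ = ω⁻³ and ψ² = ω⁻² force ψ = ω⁻¹; no
--   cubic characters intervene unless τ̄ is projectively A₄ with a cubic self-twist unramified outside
--   the conductor),

-- item stmt-Langlands-16930 · support · rank 9 · open · by planner — informal only, no Lean statement yet: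
--   [support] (sharpening of AdjointSeedFromDuality in the natural normalisation; provable now on paper)
--   Let p ≥ 5 and ρ : Γ_ℚ → GL₃(ℚ̄_p) with det ρ = ε⁻³ and residual duality ρ̄ˢˢ ≅ ρ̄ˢˢ∨ ⊗ ω̄⁻² (what
--   ρ^c ≅ ρ^∨ ⊗ ε⁻² gives at a conjugation-ramified coefficient prime: Poincaré duality on H², unitarity
--   for r_ι(π)). If ρ̄ is absolutely irreducible then ρ̄ ≅ ad⁰(τ̄) ⊗ ω⁻¹ exactly (ψ³ = ω⁻³ and ψ² = ω⁻²
--   force ψ = ω⁻¹), hence tr ρ̄(c) = +1 and τ̄ is odd. Contrapositive: tr ρ(c) = −1 ⇒ ρ̄_λ reducible at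
--   EVERY conjugation-ramified prime λ, p ≥ 5. Consequence for ExplicitRamifiedFamily: admissible member

/-- item stmt-Langlands-16782 · assembly · rank 1 · open · by planner
sources: ACCGHLNSTT2023, BuzzardGeeLMS2014
[assembly] ExplicitRamifiedFamily → AdjointSeedFromDuality → AdjointLiftingGL3 → SectorComplement →
Langlands. -/
@[route_item "route-Langlands-RamifiedCoefficientSeed"]
def Assembly : Prop :=
  ExplicitRamifiedFamily → AdjointSeedFromDuality → AdjointLiftingGL3 → SectorComplement → _root_.Langlands

/-! D-0027 §2.1 — DECIDING THEOREM (planner-authored via `route open/edit --closes-file`; by planner-plan-novel-Langlands-Langlands-e266a39d-d-v2-g8-0 2026-08-16T20:49:08Z):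
its hypotheses are this route's items and its conclusion the sub-problem Statement (glue_lint), and it elaborates with this file. -/

@[closes "route-Langlands-RamifiedCoefficientSeed"] theorem closes (h1 : ExplicitRamifiedFamily) (h2 : AdjointSeedFromDuality) (h3 : AdjointLiftingGL3)
    (h4 : SectorComplement) : _root_.Langlands := by
  refine h4 ?_
  obtain ⟨p, hp, h11, f, hne, hf⟩ := h1
  refine ⟨p, hp, h11, f, hne, fun n => (hf n).1, fun n ι hcpt => ?_⟩
  obtain ⟨hnsd, hunr, hcrys, hdual, hirr, hcc⟩ := hf n
  exact h3 p h11 (f n) hunr hcrys hirr (h2 p (le_trans (by norm_num) h11) (f n) hdual hirr hcc) ι hcpt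

end Summit.Langlands.Langlands.Theses.RamifiedCoefficientSeed
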